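import Summits.QuantumFields.YangMills.Theorems.SwapVirialDeficitBlowUpGnomonicCartHubDefs
import Summits.QuantumFields.YangMills.Theorems.SwapVirialDeficitZeroModeGroupThreeSmallBallLimit
import HarnessLib

/-!
# Route `SwapVirialDeficit` (YangMills): EVERY HUB HAS A FRAME — a unit `u` with `ū·radialUnit(axisPoint a)·u = radialUnit a`
# (brick P1b(i) of w2 g60's memo2 = plan of record for `stub_core_tip` of skeleton ➎: the hypothesis `hua` of ✓`gnoDeficitCart_gnoRot` is always satisfiable;
# free-hands support of ⟨stmt-QuantumFields-24197⟩ `SwapVirialDeficit.SwapGluedStiffness`)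

★ `exists_hubFrame` — for every `a ≠ 0` there is a unit quaternion `u` with `star u * radialUnit (axisPoint a) * u = radialUnit a` (and `star u * axisPoint a * u = a`):
generic hubs by the straightening quaternion ✓`coneQ` (`q̄ a q = |q|²·axisPoint a`, ✓`coneQ_conj`), the anti-aligned hubs `im a = −‖im a‖·i` by `u = j`, real hubs by `u = 1`.
With ✓`gnoDeficitCart_gnoRot` and ✓`hubIntegral_eq_cart`: the fixed-frame deficit computes every hub integral of skeleton ➎.

HONEST LABEL: quaternion algebra; `stub_core_tip` and the other stubs, ⟨24197⟩ ∕ ⟨24194⟩ OPEN; own crux ⟨22884⟩ `LargeFieldMassRefinementTail` OPEN (blocked-on ⟨19935⟩); the Yang–Mills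
mass gap is NOT proved; no summit is proved by a line.  THEOREMS ONLY (0 `def`, 0 `sorry`), standard axioms.  Width seat ym-line-sfw-p2-w2 g60 (cell ym-idea-1, free hands),
`--supports stmt-QuantumFields-24197`.  References: [folklore].
-/

set_option autoImplicit false

noncomputable section

open Quaternion Set
open scoped Quaternion
open Literature.MathematicalPhysics.QuantumLattice
open Literature.MathematicalPhysics.QuantumFieldTheory hiding SU2

namespace Summit.QuantumFields.YangMills.Theorems.SwapVirialDeficit.BlowUpRing

open Summit.QuantumFields.YangMills.Theorems.FemtoTransferGap
open Summit.QuantumFields.YangMills.Theorems.FemtoTransferGap.TT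
open Summit.QuantumFields.YangMills.Theorems.VirialFluxGap.RingDeficit
open Summit.QuantumFields.YangMills.Theorems.SwapVirialDeficit.SwapRing
open Literature.Analysis.Calculus (radialUnit radialUnit_def norm_radialUnit)
open Summit.QuantumFields.YangMills.Theorems.SwapTwistDeficit.ToronLog (axisPoint coneQ coneQstar coneQ_conj star_coneQ normSq_coneQ)

/-- ★ **A FRAME FOR THE STRAIGHTENED HUB**: for every `a` there is a unit quaternion `u` with `star u * axisPoint a * u = a`. [folklore] -/
theorem exists_conj_axisPoint_eq (a : ℍ) : ∃ u : ℍ, ‖u‖ = 1 ∧ star u * axisPoint a * u = a := by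
  have hrel := WeakCouplingRates.sq_norm_im a
  by_cases hN : ‖a.im‖ + a.imI = 0
  · -- `im a` is anti-aligned with `i` (or zero): `a = ⟨re, −‖im a‖, 0, 0⟩`; conjugate by `j` (or by `1` when `im a = 0`)
    have hI : a.imI = -‖a.im‖ := by linarith
    have hJK : a.imJ ^ 2 + a.imK ^ 2 = 0 := by rw [hI] at hrel; nlinarith
    have hJ : a.imJ = 0 := by nlinarith [sq_nonneg a.imJ, sq_nonneg a.imK]
    have hK : a.imK = 0 := by nlinarith [sq_nonneg a.imJ, sq_nonneg a.imK]
    set uJ : ℍ := (⟨0, 0, 1, 0⟩ : ℍ) with huJ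
    have huJe : uJ = (⟨0, 0, 1, 0⟩ : ℍ) := huJ
    refine ⟨uJ, ?_, ?_⟩
    · have h2 : ‖uJ‖ * ‖uJ‖ = 1 := by
        rw [← normSq_eq_norm_mul_self, huJe, Quaternion.normSq_def']; norm_num
      nlinarith [norm_nonneg uJ]
    · rw [huJe]
      ext <;> simp [axisPoint, hI, hJ, hK]
  · -- generic: the straightening quaternion `q = coneQ a`, `q̄ a q = |q|²·axisPoint a`; take `u = |q|⁻¹·q̄`
    have hq0 : normSq (coneQ a) ≠ 0 := by
      rw [normSq_coneQ]
      have him : ‖a.im‖ ≠ 0 := by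
        intro h0
        have : a.imI = 0 := by
          have h1 : a.imI ^ 2 ≤ ‖a.im‖ ^ 2 := by rw [hrel]; nlinarith [sq_nonneg a.imJ, sq_nonneg a.imK]
          rw [h0] at h1; nlinarith [sq_nonneg a.imI]
        exact hN (by rw [h0, this]; ring)
      exact mul_ne_zero (mul_ne_zero two_ne_zero him) hN
    have hqpos : 0 < normSq (coneQ a) := lt_of_le_of_ne (Quaternion.normSq_nonneg) (Ne.symm hq0)
    set q : ℍ := coneQ a with hq
    set N : ℝ := normSq q with hNdef
    have hqne : q ≠ 0 := fun h => hq0 (by rw [hNdef, h, map_zero])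
    have hnq : ‖q‖ ^ 2 = N := by rw [hNdef, normSq_eq_norm_mul_self, sq]
    have hnq0 : 0 < ‖q‖ := norm_pos_iff.2 hqne
    refine ⟨‖q‖⁻¹ • star q, ?_, ?_⟩
    · rw [norm_smul, norm_inv, norm_norm, Quaternion.norm_star, inv_mul_cancel₀ hnq0.ne']
    · have hconj : star q * a * q = N • axisPoint a := by rw [hq, star_coneQ, coneQ_conj]
      have hqq : q * star q = (N : ℍ) := by rw [hNdef]; exact Quaternion.self_mul_star q
      -- `q (q̄ a q) q̄ = (q q̄) a (q q̄) = N² • a` and `= N • (q · axisPoint a · q̄)`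
      have h1 : q * (star q * a * q) * star q = (N * N) • a := by
        rw [show q * (star q * a * q) * star q = (q * star q) * (a * (q * star q)) by simp only [mul_assoc], hqq,
          ← Quaternion.coe_commutes N a, ← mul_assoc, ← Quaternion.coe_mul, Quaternion.coe_mul_eq_smul]
      have h2 : q * (star q * a * q) * star q = N • (q * axisPoint a * star q) := by
        rw [hconj, mul_smul_comm, smul_mul_assoc]
      have h3 : q * axisPoint a * star q = N • a := by
        have h12 : N • (q * axisPoint a * star q) = N • (N • a) := by rw [← h2, h1, mul_smul]
        exact smul_right_injective ℍ hq0 h12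
      rw [Quaternion.star_smul, star_star, smul_mul_assoc, mul_smul_comm, smul_mul_assoc, smul_smul, h3, smul_smul]
      have hc : ‖q‖⁻¹ * ‖q‖⁻¹ * N = 1 := by
        rw [← hnq]; field_simp
      rw [hc, one_smul]

/-- ★ **EVERY HUB HAS A FRAME**: for every `a` (trivially for `a = 0`) there is a unit quaternion `u` with `star u * radialUnit (axisPoint a) * u = radialUnit a` — the hypothesis `hua` of
✓`gnoDeficitCart_gnoRot` ∕ ✓`hubIntegral_eq_cart` is always satisfiable. [folklore] -/
theorem exists_hubFrame (a : ℍ) : ∃ u : ℍ, ‖u‖ = 1 ∧ star u * radialUnit (axisPoint a) * u = radialUnit a := by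
  obtain ⟨u, hu, hconj⟩ := exists_conj_axisPoint_eq a
  refine ⟨u, hu, ?_⟩
  rw [radialUnit_def, radialUnit_def, ZeroModeGroup.norm_axisPoint, mul_smul_comm, smul_mul_assoc, hconj]

/-- ★ Consequently the fixed-frame deficit computes the chart deficit at EVERY hub `a ≠ 0` up to a rotation of the letters:
`∃ u, ‖u‖ = 1 ∧ ∀ η, F̂cart_{a,ε}(gnoRot u η) = F̂_{a,ε}(η)` (central `χ`). [cite: tHooft1979] -/
theorem exists_gnoDeficitCart_gnoRot (z : Fin 3 → Bool) {L : ℕ} [NeZero L] {χ : Site 3 L → SU2} (hχ : ∀ (x : Site 3 L) (k : SU2), k * χ x = χ x * k)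
    {a : ℍ} (ha : a ≠ 0) (ε : GnoSign L) :
    ∃ u : ℍ, ‖u‖ = 1 ∧ ∀ η : GnoCoord L, gnoDeficitCart z χ a ε (gnoRot u η) = gnoDeficit z χ a ε η := by
  obtain ⟨u, hu, hua⟩ := exists_hubFrame a
  exact ⟨u, hu, fun η => gnoDeficitCart_gnoRot z hχ ha hu hua ε η⟩

end Summit.QuantumFields.YangMills.Theorems.SwapVirialDeficit.BlowUpRing

end
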